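import Literature.Probability.Percolation.TriExplorationPolygon
import Literature.Probability.Percolation.TriSepProbEstimates
import HarnessLib

/-!
# Edges of the embedded hexagonal lattice meet only at common endpoints; hexagonal polylines are simple

Topic `Literature/Probability/Percolation`. Elementary planar geometry of the straight-line
embedding of the hexagonal (honeycomb) lattice `H`, the dual of `𝕋` — vertices at the face
centres `hexCenter`, edges the segments between the centres of adjacent faces
(`oppFace`) — needed to know that the polygon of a self-avoiding walk or cycle of `H` is a
*simple* curve: disjoint stretches of the cycle have disjoint polygons. This is the input that
makes the interface loops of critical site percolation genuine disjoint arcs in the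
multiple-traversal estimate behind
`Literature.Probability.Percolation.isTightLaws_map_triLoopCollection` (Aizenman–Burchard,
Duke Math. J. 99 (1999), App. A: "non-repeating paths"; Camia–Newman, Comm. Math. Phys. 268
(2006), §4: cluster boundaries are simple loops along the edges of the hexagonal lattice).

* The three **hex forms** `X - Y`, `X + 2Y`, `2X + Y` (in the lattice coordinates `triX`,
  `triY` of `TriLatticeSegments.lean`): every face centre has integral hex forms
  (`hform_hexCenter`), and along the edge from a face to the face opposite its `j`-th vertex one
  form is constant while the other two change by `± 1` (`hform_hexCenter_oppFace`, `hdelta`).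
  This is the same structure as for the unit edges of `𝕋` and the forms `X`, `Y`, `X + Y`, and
  the proof of `unitEdge_inter` carries over:
* `hexEdge_inter` — **two closed edges of `H` meet only at common endpoints, unless they
  coincide**;
* consequences for the dart pieces `polyPiece δ w i` of the polygon of a walk `w` of `hexGraph`
  at mesh `δ` (`TriExplorationPolygon.lean`): two pieces meet only at common endpoints unless
  they are the same edge (`polyPiece_inter`); for a self-avoiding walk or cycle, pieces `i < j`
  meet only at the common vertex of consecutive pieces or at the closing base point
  (`polyPiece_inter_of_getVert`);
* `toCurve_eq_toCurve_of_isCycle`, `toCurve_injOn_of_isCycle` — **the polygon of a cycle of `H`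
  is a simple closed curve**: its dyadic parametrisation `SimpleGraph.Walk.toCurve` is injective
  on `(0, 1 - 2^{-n}]` (`n` darts; the final `2^{-n}` is the constant tail of `polyline`,
  `tailStart n = 1 - 2^{-n}`), via abstract injectivity lemmas for `polylineFrom` through points
  `p 0, …, p n` with well-separated pieces (`GoodPieces`, `ptsList`,
  `tailStart_le_of_polylineFrom_eq`, `polylineFrom_eq_of_closed`).

Everything is folklore planar geometry, proved by lattice coordinates.

## References

* F. Camia, C. M. Newman, Comm. Math. Phys. 268 (2006), §4 (interfaces as simple loops of the
  hexagonal lattice) [CamiaNewman2006].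
* B. Bollobás, O. Riordan, *Percolation* (2006), Ch. 7 §7.2.3 (the interface graph `I` drawn on
  the hexagonal lattice).
-/

noncomputable section

open Complex Set

namespace Literature.Probability.Percolation

open LatticeModels

/-! ### The three hex forms -/

/-- The three **hex forms** `X - Y`, `X + 2Y`, `2X + Y` whose integral level lines carry the
edges of the embedded hexagonal lattice (each edge direction keeps one of them constant).
[folklore] -/
def hform (i : Fin 3) (p : ℂ) : ℝ := ![triX p - triY p, triX p + 2 * triY p, 2 * triX p + triY p] i

/-- `hform 0 = X - Y`. [folklore] -/
@[simp] theorem hform_zero (p : ℂ) : hform 0 p = triX p - triY p := rfl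

/-- `hform 1 = X + 2Y`. [folklore] -/
@[simp] theorem hform_one (p : ℂ) : hform 1 p = triX p + 2 * triY p := rfl

/-- `hform 2 = 2X + Y`. [folklore] -/
@[simp] theorem hform_two (p : ℂ) : hform 2 p = 2 * triX p + triY p := rfl

/-- The hex forms are affine along segments. [folklore] -/
theorem hform_lineMap (i : Fin 3) (c c' : ℂ) (φ : ℝ) :
    hform i (c + φ • (c' - c)) = hform i c + φ * (hform i c' - hform i c) := by
  fin_cases i
  · change triX _ - triY _ = triX c - triY c + φ * (triX c' - triY c' - (triX c - triY c))
    rw [triX_lineMap, triY_lineMap]; ring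
  · change triX _ + 2 * triY _ = triX c + 2 * triY c + φ * (triX c' + 2 * triY c' - (triX c + 2 * triY c))
    rw [triX_lineMap, triY_lineMap]; ring
  · change 2 * triX _ + triY _ = 2 * triX c + triY c + φ * (2 * triX c' + triY c' - (2 * triX c + triY c))
    rw [triX_lineMap, triY_lineMap]; ring

/-- **Two hex forms determine the point.** [folklore] -/
theorem eq_of_hform_eq {p q : ℂ} {i i' : Fin 3} (hne : i ≠ i') (h1 : hform i p = hform i q)
    (h2 : hform i' p = hform i' q) : p = q := by
  have key : triX p = triX q ∧ triY p = triY q := by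
    revert hne h1 h2
    fin_cases i <;> fin_cases i' <;> simp [hform] <;> intro h1 h2 <;> constructor <;> linarith
  exact triXY_ext key.1 key.2

/-- The integral values of the hex forms at the centre of the face `(x, t)`:
`(x₀ - x₁, x₀ + 2x₁ + t + 1, 2x₀ + x₁ + t + 1)`. [folklore] -/
def hformZ (i : Fin 3) (x : Site 2) (t : Fin 2) : ℤ :=
  ![x 0 - x 1, x 0 + 2 * x 1 + ((t : ℕ) + 1), 2 * x 0 + x 1 + ((t : ℕ) + 1)] i

/-- **Face centres have integral hex forms.** [folklore] -/
theorem hform_hexCenter (i : Fin 3) (x : Site 2) (t : Fin 2) :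
    hform i (hexCenter (x, t)) = ((hformZ i x t : ℤ) : ℝ) := by
  fin_cases i <;> simp [hform, hformZ, triX_hexCenter, triY_hexCenter] <;> ring

/-- The change of the `i`-th hex form from the centre of a face of type `t` (up/down) to the
centre of the face opposite its `j`-th vertex. [folklore] -/
def hdelta (t : Fin 2) (j : Fin 3) (i : Fin 3) : ℝ :=
  ![![![(0 : ℝ), 1, 1], ![-1, 0, -1], ![1, -1, 0]],
    ![![(-1 : ℝ), 1, 0], ![0, -1, -1], ![1, 0, 1]]] t j i

/-- The hex form constant along the edge towards the face opposite the `j`-th vertex (its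
"type"). [folklore] -/
def htype (t : Fin 2) (j : Fin 3) : Fin 3 := ![![(0 : Fin 3), 1, 2], ![2, 0, 1]] t j

/-- The type form does not change along its edge. [folklore] -/
theorem hdelta_htype (t : Fin 2) (j : Fin 3) : hdelta t j (htype t j) = 0 := by
  fin_cases t <;> fin_cases j <;> simp [hdelta, htype]

/-- The other two hex forms change by `± 1` along an edge. [folklore] -/
theorem hdelta_eq_one_or_of_ne {t : Fin 2} {j i : Fin 3} (h : i ≠ htype t j) :
    hdelta t j i = 1 ∨ hdelta t j i = -1 := by
  revert h; fin_cases t <;> fin_cases j <;> fin_cases i <;> simp [hdelta, htype]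

/-- **The hex forms along an edge of `H`**: `μ_i(c(oppFace F j)) = μ_i(c F) + Δ_i`.
[folklore] -/
theorem hform_hexCenter_oppFace (i : Fin 3) (F : HexVertex) (j : Fin 3) :
    hform i (hexCenter (oppFace F j)) = hform i (hexCenter F) + hdelta F.2 j i := by
  rcases F with ⟨x, t⟩
  obtain rfl | rfl : t = 0 ∨ t = 1 := by
    rcases Fin.exists_fin_two.1 ⟨t, rfl⟩ with h' | h'
    · exact Or.inl h'
    · exact Or.inr h'
  · fin_cases j <;> fin_cases i <;>
      simp [oppFace, hform_hexCenter, hformZ, hdelta, sub_eq_add_neg] <;> ring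
  · fin_cases j <;> fin_cases i <;>
      simp [oppFace, hform_hexCenter, hformZ, hdelta] <;> ring

/-! ### Points of an edge of `H` -/

/-- **The hex forms along a closed edge**: a point of the segment from the centre of `F` to the
centre of `oppFace F j` is `c F + θ Δ`, `θ ∈ [0, 1]`, in every form. [folklore] -/
theorem exists_param_of_mem_hexEdge {F : HexVertex} {j : Fin 3} {p : ℂ}
    (hp : p ∈ segment ℝ (hexCenter F) (hexCenter (oppFace F j))) :
    ∃ θ : ℝ, 0 ≤ θ ∧ θ ≤ 1 ∧ ∀ i, hform i p = hform i (hexCenter F) + θ * hdelta F.2 j i := by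
  rw [segment_eq_image'] at hp
  obtain ⟨θ, ⟨h0, h1⟩, rfl⟩ := hp
  refine ⟨θ, h0, h1, fun i => ?_⟩
  rw [hform_lineMap, hform_hexCenter_oppFace]; ring

/-- A point of an edge of `H` with parameter `θ = 0` or `θ = 1` is an endpoint. [folklore] -/
theorem eq_endpoint_of_hparam {F : HexVertex} {j : Fin 3} {q : ℂ} {θ : ℝ}
    (h : ∀ i, hform i q = hform i (hexCenter F) + θ * hdelta F.2 j i) (hθ : θ = 0 ∨ θ = 1) :
    q = hexCenter F ∨ q = hexCenter (oppFace F j) := by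
  have hi : (0 : Fin 3) ≠ 1 := by decide
  rcases hθ with rfl | rfl
  · left
    exact eq_of_hform_eq hi (by rw [h, zero_mul, add_zero]) (by rw [h, zero_mul, add_zero])
  · right
    exact eq_of_hform_eq hi (by rw [h, hform_hexCenter_oppFace, one_mul])
      (by rw [h, hform_hexCenter_oppFace, one_mul])

/-- A real in `[0, 1]` whose product with a sign is an integer is `0` or `1`. [folklore] -/
theorem eq_zero_or_one_of_mul_sign_int {θ ε : ℝ} (h0 : 0 ≤ θ) (h1 : θ ≤ 1) (hε : ε = 1 ∨ ε = -1)
    {n : ℤ} (hn : θ * ε = n) : θ = 0 ∨ θ = 1 := by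
  rcases hε with rfl | rfl
  · rw [mul_one] at hn
    rcases eq_or_lt_of_le h0 with h | h
    · exact Or.inl h.symm
    rcases eq_or_lt_of_le h1 with h' | h'
    · exact Or.inr h'
    exact (int_not_strict_between (n := n) (m := 0) (by push_cast; linarith) (by push_cast; linarith)).elim
  · rw [mul_neg_one] at hn
    rcases eq_or_lt_of_le h0 with h | h
    · exact Or.inl h.symm
    rcases eq_or_lt_of_le h1 with h' | h'
    · exact Or.inr h'
    exact (int_not_strict_between (n := n) (m := -1) (by push_cast; linarith) (by push_cast; linarith)).elim

/-- **Two closed edges of the hexagonal lattice meet only at common endpoints, unless they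
coincide**: a common point of the segments from the centre of `F` to the centre of
`oppFace F j` and from the centre of `G` to the centre of `oppFace G l` is an endpoint of both,
or the two edges have the same endpoints (in one of the two orientations). Proof by the hex
forms: if the two edges have different types, the type form of each is an integer along the
other, forcing endpoint parameters; if they have the same type they lie on one lattice line and
`unit_intervals` applies. [folklore] -/
theorem hexEdge_inter {F G : HexVertex} {j l : Fin 3} {q : ℂ}
    (hq1 : q ∈ segment ℝ (hexCenter F) (hexCenter (oppFace F j)))
    (hq2 : q ∈ segment ℝ (hexCenter G) (hexCenter (oppFace G l))) :
    ((q = hexCenter F ∨ q = hexCenter (oppFace F j)) ∧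
        (q = hexCenter G ∨ q = hexCenter (oppFace G l))) ∨
      (F = G ∧ oppFace F j = oppFace G l) ∨ (F = oppFace G l ∧ oppFace F j = G) := by
  obtain ⟨θ, h0, h1, hθ⟩ := exists_param_of_mem_hexEdge hq1
  obtain ⟨ψ, h0', h1', hψ⟩ := exists_param_of_mem_hexEdge hq2
  rcases F with ⟨x, t⟩
  rcases G with ⟨y, u⟩
  by_cases ht : htype t j = htype u l
  · -- same type: both edges on the same lattice line
    set τ := htype t j with hτ
    have ht' : htype t j = htype u l := ht
    have htj : hdelta t j τ = 0 := hdelta_htype t j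
    have hul : hdelta u l τ = 0 := by
      change hdelta u l (htype t j) = 0
      rw [ht']; exact hdelta_htype u l
    have hi : τ + 1 ≠ τ := by fin_cases t <;> fin_cases j <;> simp [hτ, htype]
    have hi' : τ + 1 ≠ htype u l := by rw [← ht]; exact hi
    have hεk := hdelta_eq_one_or_of_ne hi
    have hεl := hdelta_eq_one_or_of_ne hi'
    have hline : hform τ (hexCenter (x, t)) = hform τ (hexCenter (y, u)) := by
      have e1 := hθ τ; have e2 := hψ τ
      rw [show hdelta (x, t).2 j τ = 0 from htj, mul_zero, add_zero] at e1
      rw [show hdelta (y, u).2 l τ = 0 from hul, mul_zero, add_zero] at e2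
      rw [← e1, ← e2]
    have hA := hθ (τ + 1); have hC := hψ (τ + 1)
    rw [hform_hexCenter] at hA hC
    have key := unit_intervals (A := hformZ (τ + 1) x t) (C := hformZ (τ + 1) y u)
      hεk hεl h0 h1 h0' h1' (by rw [← hA, ← hC])
    rcases key with ⟨hθ01, hψ01⟩ | ⟨hAC, hεε, -⟩ | ⟨hAC, hCA, -⟩
    · exact Or.inl ⟨eq_endpoint_of_hparam hθ hθ01, eq_endpoint_of_hparam hψ hψ01⟩
    · right; left
      have hFG : hexCenter (x, t) = hexCenter (y, u) := by
        refine eq_of_hform_eq hi.symm hline ?_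
        rw [hform_hexCenter, hform_hexCenter]; exact_mod_cast hAC
      refine ⟨hexCenter_injective hFG, hexCenter_injective ?_⟩
      refine eq_of_hform_eq hi.symm ?_ ?_
      · rw [hform_hexCenter_oppFace, hform_hexCenter_oppFace,
          show hdelta (x, t).2 j τ = 0 from htj, show hdelta (y, u).2 l τ = 0 from hul, hline]
      · rw [hform_hexCenter_oppFace, hform_hexCenter_oppFace, hform_hexCenter, hform_hexCenter]
        change ((hformZ (τ + 1) x t : ℤ) : ℝ) + hdelta t j (τ + 1) = (hformZ (τ + 1) y u : ℝ) + hdelta u l (τ + 1)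
        rw [hεε]; exact_mod_cast congrArg (fun z : ℝ => z + hdelta u l (τ + 1)) (show ((hformZ (τ + 1) x t : ℤ) : ℝ) = _ from by exact_mod_cast hAC)
    · right; right
      constructor
      · apply hexCenter_injective
        refine eq_of_hform_eq hi.symm ?_ ?_
        · rw [hform_hexCenter_oppFace, show hdelta (y, u).2 l τ = 0 from hul, add_zero, hline]
        · rw [hform_hexCenter_oppFace, hform_hexCenter, hform_hexCenter]; exact hCA.symm
      · apply hexCenter_injective
        refine eq_of_hform_eq hi.symm ?_ ?_
        · rw [hform_hexCenter_oppFace, show hdelta (x, t).2 j τ = 0 from htj, add_zero, hline]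
        · rw [hform_hexCenter_oppFace, hform_hexCenter, hform_hexCenter]; exact hAC
  · -- different types: the type form of each edge is integral along the other
    left
    constructor
    · -- along edge 1 the form `htype u l` varies by `± θ` and is an integer at `q`
      have hvar := hdelta_eq_one_or_of_ne (t := t) (j := j) (i := htype u l) (Ne.symm ht)
      have hint : hform (htype u l) q = ((hformZ (htype u l) y u : ℤ) : ℝ) := by
        rw [hψ, hdelta_htype, mul_zero, add_zero, hform_hexCenter]
      have e1 := hθ (htype u l)
      rw [hint, hform_hexCenter] at e1
      have hn : θ * hdelta t j (htype u l) = ((hformZ (htype u l) y u - hformZ (htype u l) x t : ℤ) : ℝ) := by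
        push_cast; linarith
      exact eq_endpoint_of_hparam hθ (eq_zero_or_one_of_mul_sign_int h0 h1 hvar hn)
    · have hvar := hdelta_eq_one_or_of_ne (t := u) (j := l) (i := htype t j) ht
      have hint : hform (htype t j) q = ((hformZ (htype t j) x t : ℤ) : ℝ) := by
        rw [hθ, hdelta_htype, mul_zero, add_zero, hform_hexCenter]
      have e1 := hψ (htype t j)
      rw [hint, hform_hexCenter] at e1
      have hn : ψ * hdelta u l (htype t j) = ((hformZ (htype t j) x t - hformZ (htype t j) y u : ℤ) : ℝ) := by
        push_cast; linarith
      exact eq_endpoint_of_hparam hψ (eq_zero_or_one_of_mul_sign_int h0' h1' hvar hn)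

/-! ### Dart pieces of a walk of `H` at mesh `δ` -/

section Pieces

variable {f₀ g₀ : HexVertex} {δ : ℝ} {w : hexGraph.Walk f₀ g₀}

/-- Consecutive polygon vertices are distinct (adjacent faces have distinct centres).
[folklore] -/
theorem polyPt_ne_polyPt_succ (hδ : δ ≠ 0) {i : ℕ} (hi : i < w.length) :
    polyPt δ w i ≠ polyPt δ w (i + 1) := by
  intro h
  have h' : hexCenter (w.getVert i) = hexCenter (w.getVert (i + 1)) :=
    mul_left_cancel₀ (Complex.ofReal_ne_zero.2 hδ) h
  exact (w.adj_getVert_succ hi).ne (hexCenter_injective h')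

/-- Distinct polygon vertices come from distinct faces; equal ones from equal faces. [folklore] -/
theorem getVert_eq_of_polyPt_eq (hδ : δ ≠ 0) {a b : ℕ} (h : polyPt δ w a = polyPt δ w b) :
    w.getVert a = w.getVert b :=
  hexCenter_injective (mul_left_cancel₀ (Complex.ofReal_ne_zero.2 hδ) h)

/-- **Two dart pieces of a walk of `H` meet only at common endpoints, unless they are the same
edge** (`hexEdge_inter` at mesh `δ`). [folklore] -/
theorem polyPiece_inter (hδ : δ ≠ 0) {i j : ℕ} (hi : i < w.length) (hj : j < w.length) {z : ℂ}
    (hz₁ : z ∈ polyPiece δ w i) (hz₂ : z ∈ polyPiece δ w j) :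
    ((z = polyPt δ w i ∨ z = polyPt δ w (i + 1)) ∧ (z = polyPt δ w j ∨ z = polyPt δ w (j + 1))) ∨
      (w.getVert i = w.getVert j ∧ w.getVert (i + 1) = w.getVert (j + 1)) ∨
      (w.getVert i = w.getVert (j + 1) ∧ w.getVert (i + 1) = w.getVert j) := by
  obtain ⟨a, ha⟩ := exists_oppFace_eq_of_hexGraph_adj (w.adj_getVert_succ hi)
  obtain ⟨b, hb⟩ := exists_oppFace_eq_of_hexGraph_adj (w.adj_getVert_succ hj)
  have hz₁' := hz₁
  have hz₂' := hz₂
  rw [polyPiece, polyPt, polyPt, mem_segment_mul_iff hδ, ha] at hz₁'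
  rw [polyPiece, polyPt, polyPt, mem_segment_mul_iff hδ, hb] at hz₂'
  have hsc : ∀ F : HexVertex, (δ⁻¹ : ℝ) • z = hexCenter F → z = (δ : ℂ) * hexCenter F := by
    intro F h
    rw [← h, Complex.real_smul, Complex.ofReal_inv, ← mul_assoc,
      mul_inv_cancel₀ (Complex.ofReal_ne_zero.2 hδ), one_mul]
  rcases hexEdge_inter hz₁' hz₂' with ⟨h1, h2⟩ | ⟨h1, h2⟩ | ⟨h1, h2⟩
  · left
    refine ⟨?_, ?_⟩
    · rcases h1 with h | h
      · exact Or.inl (hsc _ h)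
      · refine Or.inr ?_; rw [polyPt, ha]; exact hsc _ h
    · rcases h2 with h | h
      · exact Or.inl (hsc _ h)
      · refine Or.inr ?_; rw [polyPt, hb]; exact hsc _ h
  · exact Or.inr (Or.inl ⟨h1, by rw [ha, hb]; exact h2⟩)
  · exact Or.inr (Or.inr ⟨by rw [hb]; exact h1, by rw [ha]; exact h2⟩)

/-- **Pieces of a self-avoiding walk or cycle**: if the faces `w.getVert 0, …, w.getVert n`
(`n = w.length ≥ 3`) are distinct except possibly for `w.getVert 0 = w.getVert n`, then for
`i < j` a common point of the `i`-th and `j`-th dart pieces is the common vertex of consecutive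
pieces (`j = i + 1`), or the base point where the last piece closes up to the first
(`i = 0`, `j = n - 1`). [folklore] -/
theorem polyPiece_inter_of_getVert (hδ : δ ≠ 0) (hlen : 3 ≤ w.length)
    (hinj : ∀ a b, a < b → b ≤ w.length → w.getVert a = w.getVert b → a = 0 ∧ b = w.length)
    {i j : ℕ} (hij : i < j) (hj : j < w.length) {z : ℂ}
    (hz₁ : z ∈ polyPiece δ w i) (hz₂ : z ∈ polyPiece δ w j) :
    (j = i + 1 ∧ z = polyPt δ w (i + 1)) ∨ (i = 0 ∧ j + 1 = w.length ∧ z = polyPt δ w 0) := by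
  have hi : i < w.length := hij.trans hj
  rcases polyPiece_inter hδ hi hj hz₁ hz₂ with ⟨h1, h2⟩ | ⟨h1, -⟩ | ⟨h1, h2⟩
  · rcases h1 with rfl | rfl <;> rcases h2 with h | h
    · obtain ⟨-, h3⟩ := hinj i j hij hj.le (getVert_eq_of_polyPt_eq hδ h); omega
    · obtain ⟨h3, h4⟩ := hinj i (j + 1) (by omega) (by omega) (getVert_eq_of_polyPt_eq hδ h)
      subst h3
      exact Or.inr ⟨rfl, h4, rfl⟩
    · rcases Nat.lt_or_ge (i + 1) j with h' | h'
      · obtain ⟨h3, -⟩ := hinj (i + 1) j h' hj.le (getVert_eq_of_polyPt_eq hδ h); omega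
      · exact Or.inl ⟨by omega, rfl⟩
    · obtain ⟨h3, -⟩ := hinj (i + 1) (j + 1) (by omega) (by omega) (getVert_eq_of_polyPt_eq hδ h)
      omega
  · obtain ⟨-, h3⟩ := hinj i j hij hj.le h1; omega
  · rcases Nat.lt_or_ge (i + 1) j with h' | h'
    · obtain ⟨h3, -⟩ := hinj (i + 1) j h' hj.le h2; omega
    · have hj' : j = i + 1 := by omega
      subst hj'
      obtain ⟨h4, h3⟩ := hinj i (i + 1 + 1) (by omega) (by omega) h1
      omega

end Pieces

/-! ### Injectivity of polylines with well-separated pieces -/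

section PolylineInj

variable {E : Type*} [AddCommGroup E] [Module ℝ E] [TopologicalSpace E] [ContinuousAdd E]
  [ContinuousSMul ℝ E]

/-- The list `[p 1, …, p n]` of the points after the first, so that
`polylineFrom (p 0) (ptsList p n)` is the polyline through `p 0, …, p n` (definitionally
`ptsList p (n + 1) = p 1 :: ptsList (p ∘ succ) n`). [folklore] -/
def ptsList (p : ℕ → E) : ℕ → List E
  | 0 => []
  | n + 1 => p 1 :: ptsList (fun k => p (k + 1)) n

omit [AddCommGroup E] [Module ℝ E] [TopologicalSpace E] [ContinuousAdd E] [ContinuousSMul ℝ E] in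
/-- `ptsList p n` has length `n`. [folklore] -/
@[simp] theorem length_ptsList (p : ℕ → E) : ∀ n, (ptsList p n).length = n
  | 0 => rfl
  | n + 1 => by rw [ptsList, List.length_cons, length_ptsList]

omit [AddCommGroup E] [Module ℝ E] [TopologicalSpace E] [ContinuousAdd E] [ContinuousSMul ℝ E] in
/-- The `k`-th point of `ptsList p n` is `p (k + 1)`. [folklore] -/
theorem getElem_ptsList (p : ℕ → E) : ∀ (n k : ℕ) (hk : k < (ptsList p n).length),
    (ptsList p n)[k] = p (k + 1)
  | 0, k, hk => by simp at hk
  | n + 1, 0, _ => rfl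
  | n + 1, k + 1, hk => by
    change (ptsList (fun k => p (k + 1)) n)[k]'(by simpa [ptsList] using hk) = p (k + 1 + 1)
    rw [getElem_ptsList]

/-- **The range of the polyline through `p 0, …, p n`**: the first point or a point of one of
the `n` segments. [folklore] -/
theorem mem_segment_of_mem_range_polylineFrom_ptsList :
    ∀ (p : ℕ → E) (n : ℕ) {z : E}, z ∈ Set.range (polylineFrom (p 0) (ptsList p n)).2 →
      z = p 0 ∨ ∃ k, k < n ∧ z ∈ segment ℝ (p k) (p (k + 1))
  | p, 0, z, hz => by
    obtain ⟨u, rfl⟩ := hz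
    exact Or.inl rfl
  | p, n + 1, z, hz => by
    change z ∈ Set.range ((Path.segment (p 0) (p 1)).trans (polylineFrom (p 1) (ptsList (fun k => p (k + 1)) n)).2) at hz
    rw [Path.trans_range, Path.range_segment] at hz
    rcases hz with hz | hz
    · exact Or.inr ⟨0, Nat.succ_pos _, hz⟩
    · rcases mem_segment_of_mem_range_polylineFrom_ptsList (fun k => p (k + 1)) n hz with rfl | ⟨k, hk, h⟩
      · exact Or.inr ⟨0, Nat.succ_pos _, right_mem_segment _ _ _⟩
      · exact Or.inr ⟨k + 1, by omega, h⟩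

/-- The start of the constant tail of a polyline with `n` segments in the dyadic
parametrisation of `polylineFrom`: `1 - 2^{-n}`. [folklore] -/
def tailStart (n : ℕ) : ℝ := 1 - (1 / 2 : ℝ) ^ n

/-- `tailStart 0 = 0`. [folklore] -/
@[simp] theorem tailStart_zero : tailStart 0 = 0 := by simp [tailStart]

/-- The recursion `tailStart (n + 1) = (1 + tailStart n) / 2`. [folklore] -/
theorem tailStart_succ (n : ℕ) : tailStart (n + 1) = (1 + tailStart n) / 2 := by
  simp only [tailStart, pow_succ]; ring

/-- `0 ≤ tailStart n`. [folklore] -/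
theorem tailStart_nonneg (n : ℕ) : 0 ≤ tailStart n := by
  have : (1 / 2 : ℝ) ^ n ≤ 1 := pow_le_one₀ (by norm_num) (by norm_num)
  simp only [tailStart]; linarith

/-- `tailStart n < 1`. [folklore] -/
theorem tailStart_lt_one (n : ℕ) : tailStart n < 1 := by
  have : 0 < (1 / 2 : ℝ) ^ n := by positivity
  simp only [tailStart]; linarith

/-- The doubled time `2s` (for `s ≤ 1/2`), as in `Path.trans_apply`. [folklore] -/
def dblTime (s : unitInterval) (hs : (s : ℝ) ≤ 1 / 2) : unitInterval :=
  ⟨2 * s, (unitInterval.mul_pos_mem_iff zero_lt_two).2 ⟨s.2.1, hs⟩⟩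

/-- The time `2t - 1` (for `t > 1/2`), as in `Path.trans_apply`. [folklore] -/
def dblTime' (t : unitInterval) (ht : ¬ (t : ℝ) ≤ 1 / 2) : unitInterval :=
  ⟨2 * t - 1, unitInterval.two_mul_sub_one_mem_iff.2 ⟨(not_le.1 ht).le, t.2.2⟩⟩

/-- `Path.trans` on the first half. [folklore] -/
theorem trans_apply_of_le {X : Type*} [TopologicalSpace X] {x y z : X} (γ : Path x y)
    (γ' : Path y z) {s : unitInterval} (hs : (s : ℝ) ≤ 1 / 2) : (γ.trans γ') s = γ (dblTime s hs) := by
  rw [Path.trans_apply, dif_pos hs]; rfl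

/-- `Path.trans` on the second half. [folklore] -/
theorem trans_apply_of_not_le {X : Type*} [TopologicalSpace X] {x y z : X} (γ : Path x y)
    (γ' : Path y z) {t : unitInterval} (ht : ¬ (t : ℝ) ≤ 1 / 2) :
    (γ.trans γ') t = γ' (dblTime' t ht) := by
  rw [Path.trans_apply, dif_neg ht]; rfl

/-- **Well-separated pieces**: consecutive points distinct, and the segment `[p k, p (k+1)]`
meets a later segment `[p m, p (m+1)]`, `k < m < n`, only at `p (k+1)`. [folklore] -/
def GoodPieces (p : ℕ → E) (n : ℕ) : Prop :=
  (∀ k, k < n → p k ≠ p (k + 1)) ∧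
    ∀ k m, k < m → m < n → ∀ z ∈ segment ℝ (p k) (p (k + 1)), z ∈ segment ℝ (p m) (p (m + 1)) →
      z = p (k + 1)

omit [TopologicalSpace E] [ContinuousAdd E] [ContinuousSMul ℝ E] in
/-- Shifting well-separated pieces. [folklore] -/
theorem GoodPieces.succ {p : ℕ → E} {n : ℕ} (h : GoodPieces p (n + 1)) :
    GoodPieces (fun k => p (k + 1)) n :=
  ⟨fun k hk => h.1 (k + 1) (by omega), fun k m hkm hm z hz hz' => h.2 (k + 1) (m + 1) (by omega) (by omega) z hz hz'⟩

/-- **Injectivity of a polyline with well-separated pieces, up to the constant tail**: if the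
polyline through `p 0, …, p n` takes the same value at times `s < t`, then `s` (hence `t`)
lies in the final constant stretch `[1 - 2^{-n}, 1]`. [folklore] -/
theorem tailStart_le_of_polylineFrom_eq [T2Space E] :
    ∀ (p : ℕ → E) (n : ℕ), GoodPieces p n → ∀ {s t : unitInterval}, s < t →
      (polylineFrom (p 0) (ptsList p n)).2 s = (polylineFrom (p 0) (ptsList p n)).2 t →
        tailStart n ≤ (s : ℝ)
  | p, 0, _, s, t, _, _ => by rw [tailStart_zero]; exact s.2.1
  | p, n + 1, hg, s, t, hst, heq => by
    have hab : p 0 ≠ p 1 := hg.1 0 (Nat.succ_pos _)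
    change ((Path.segment (p 0) (p 1)).trans (polylineFrom (p 1) (ptsList (fun k => p (k + 1)) n)).2) s =
      ((Path.segment (p 0) (p 1)).trans (polylineFrom (p 1) (ptsList (fun k => p (k + 1)) n)).2) t at heq
    set P' := (polylineFrom (p 1) (ptsList (fun k => p (k + 1)) n)).2 with hP'
    have hst' : (s : ℝ) < t := hst
    by_cases hs : (s : ℝ) ≤ 1 / 2 <;> by_cases ht : (t : ℝ) ≤ 1 / 2
    · rw [trans_apply_of_le _ _ hs, trans_apply_of_le _ _ ht] at heq
      have h1 := Path.segment_injective_of_ne hab heq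
      have h2 : (2 * (s : ℝ)) = 2 * t := congrArg Subtype.val h1
      linarith
    · rw [trans_apply_of_le _ _ hs, trans_apply_of_not_le _ _ ht] at heq
      -- the common value is on the first segment and on the rest, hence is `p 1`
      have hmem : Path.segment (p 0) (p 1) (dblTime s hs) ∈ segment ℝ (p 0) (p 1) := by
        rw [← Path.range_segment (p 0) (p 1)]; exact ⟨_, rfl⟩
      have hval : Path.segment (p 0) (p 1) (dblTime s hs) = p 1 := by
        rcases mem_segment_of_mem_range_polylineFrom_ptsList (fun k => p (k + 1)) n ⟨_, heq.symm⟩ with h | ⟨k, hk, h⟩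
        · exact h
        · exact hg.2 0 (k + 1) (by omega) (by omega) _ hmem h
      -- so `2 s = 1`
      have h2s : 2 * (s : ℝ) = 1 := by
        have h1 : Path.segment (p 0) (p 1) (dblTime s hs) = Path.segment (p 0) (p 1) 1 := by
          rw [hval, Path.target]
        exact congrArg Subtype.val (Path.segment_injective_of_ne hab h1)
      -- and the rest returns to its starting point `p 1` at the positive time `2t - 1`
      have h0 : (0 : unitInterval) < dblTime' t ht := by
        change (0 : ℝ) < 2 * t - 1; linarith [not_le.1 ht]
      have hP0 : P' 0 = P' (dblTime' t ht) := by rw [Path.source, ← heq, hval]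
      have ih := tailStart_le_of_polylineFrom_eq (fun k => p (k + 1)) n hg.succ h0 hP0
      change tailStart n ≤ (0 : ℝ) at ih
      rw [tailStart_succ]
      linarith [tailStart_nonneg n]
    · exfalso; linarith [not_le.1 hs]
    · rw [trans_apply_of_not_le _ _ hs, trans_apply_of_not_le _ _ ht] at heq
      have h' : dblTime' s hs < dblTime' t ht := by
        change 2 * (s : ℝ) - 1 < 2 * t - 1; linarith
      have ih := tailStart_le_of_polylineFrom_eq (fun k => p (k + 1)) n hg.succ h' heq
      change tailStart n ≤ 2 * (s : ℝ) - 1 at ih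
      rw [tailStart_succ]
      linarith

/-- The polyline through `p 0, …, p n` ends at `p n`. [folklore] -/
theorem polylineFrom_ptsList_fst : ∀ (p : ℕ → E) (n : ℕ), (polylineFrom (p 0) (ptsList p n)).1 = p n
  | p, 0 => rfl
  | p, n + 1 => by
    change (polylineFrom (p 1) (ptsList (fun k => p (k + 1)) n)).1 = p (n + 1)
    exact polylineFrom_ptsList_fst (fun k => p (k + 1)) n

/-- **Injectivity of a closed polyline with well-separated pieces**: if the polyline through
`p 0, p 1, …, p (n+1) = p 0` (first segment meeting the others only at `p 1` and, at the end, at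
`p 0`; the remaining pieces well separated) takes the same value at times `s < t`, then either
`s` lies in the final constant stretch, or `s = 0` and `t` lies in it (the closing point).
[folklore] -/
theorem polylineFrom_eq_of_closed [T2Space E] (p : ℕ → E) (n : ℕ) (hab : p 0 ≠ p 1)
    (hfirst : ∀ m, 1 ≤ m → m < n + 1 → ∀ z ∈ segment ℝ (p 0) (p 1), z ∈ segment ℝ (p m) (p (m + 1)) →
      z = p 0 ∨ z = p 1)
    (hgood : GoodPieces (fun k => p (k + 1)) n) (hclosed : p (n + 1) = p 0)
    {s t : unitInterval} (hst : s < t)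
    (heq : (polylineFrom (p 0) (ptsList p (n + 1))).2 s = (polylineFrom (p 0) (ptsList p (n + 1))).2 t) :
    tailStart (n + 1) ≤ (s : ℝ) ∨ ((s : ℝ) = 0 ∧ tailStart (n + 1) ≤ (t : ℝ)) := by
  change ((Path.segment (p 0) (p 1)).trans (polylineFrom (p 1) (ptsList (fun k => p (k + 1)) n)).2) s =
    ((Path.segment (p 0) (p 1)).trans (polylineFrom (p 1) (ptsList (fun k => p (k + 1)) n)).2) t at heq
  set P' := (polylineFrom (p 1) (ptsList (fun k => p (k + 1)) n)).2 with hP'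
  have hP'1 : P' 1 = p 0 := by
    rw [Path.target, ← hclosed]; exact polylineFrom_ptsList_fst (fun k => p (k + 1)) n
  have hst' : (s : ℝ) < t := hst
  by_cases hs : (s : ℝ) ≤ 1 / 2 <;> by_cases ht : (t : ℝ) ≤ 1 / 2
  · rw [trans_apply_of_le _ _ hs, trans_apply_of_le _ _ ht] at heq
    have h1 := Path.segment_injective_of_ne hab heq
    have h2 : (2 * (s : ℝ)) = 2 * t := congrArg Subtype.val h1
    exfalso; linarith
  · rw [trans_apply_of_le _ _ hs, trans_apply_of_not_le _ _ ht] at heq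
    have hmem : Path.segment (p 0) (p 1) (dblTime s hs) ∈ segment ℝ (p 0) (p 1) := by
      rw [← Path.range_segment (p 0) (p 1)]; exact ⟨_, rfl⟩
    have hval : Path.segment (p 0) (p 1) (dblTime s hs) = p 0 ∨
        Path.segment (p 0) (p 1) (dblTime s hs) = p 1 := by
      rcases mem_segment_of_mem_range_polylineFrom_ptsList (fun k => p (k + 1)) n ⟨_, heq.symm⟩ with h | ⟨k, hk, h⟩
      · exact Or.inr h
      · exact hfirst (k + 1) (by omega) (by omega) _ hmem h
    rcases hval with hval | hval
    · -- the value is the base point `p 0`: `s = 0`, and the rest is back at `p 0` at time `2t - 1`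
      right
      have h2s : 2 * (s : ℝ) = 0 := by
        have h1 : Path.segment (p 0) (p 1) (dblTime s hs) = Path.segment (p 0) (p 1) 0 := by
          rw [hval, Path.source]
        exact congrArg Subtype.val (Path.segment_injective_of_ne hab h1)
      refine ⟨by linarith, ?_⟩
      rcases eq_or_lt_of_le (dblTime' t ht).2.2 with h1 | h1
      · -- `2t - 1 = 1`
        change 2 * (t : ℝ) - 1 = 1 at h1
        linarith [tailStart_lt_one (n + 1)]
      · have hlt : dblTime' t ht < 1 := h1
        have hP : P' (dblTime' t ht) = P' 1 := by rw [hP'1, ← heq, hval]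
        have ih := tailStart_le_of_polylineFrom_eq (fun k => p (k + 1)) n hgood hlt hP
        change tailStart n ≤ 2 * (t : ℝ) - 1 at ih
        rw [tailStart_succ]; linarith
    · left
      have h2s : 2 * (s : ℝ) = 1 := by
        have h1 : Path.segment (p 0) (p 1) (dblTime s hs) = Path.segment (p 0) (p 1) 1 := by
          rw [hval, Path.target]
        exact congrArg Subtype.val (Path.segment_injective_of_ne hab h1)
      have h0 : (0 : unitInterval) < dblTime' t ht := by
        change (0 : ℝ) < 2 * t - 1; linarith [not_le.1 ht]
      have hP0 : P' 0 = P' (dblTime' t ht) := by rw [Path.source, ← heq, hval]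
      have ih := tailStart_le_of_polylineFrom_eq (fun k => p (k + 1)) n hgood h0 hP0
      change tailStart n ≤ (0 : ℝ) at ih
      rw [tailStart_succ]
      linarith [tailStart_nonneg n]
  · exfalso; linarith [not_le.1 hs]
  · left
    rw [trans_apply_of_not_le _ _ hs, trans_apply_of_not_le _ _ ht] at heq
    have h' : dblTime' s hs < dblTime' t ht := by
      change 2 * (s : ℝ) - 1 < 2 * t - 1; linarith
    have ih := tailStart_le_of_polylineFrom_eq (fun k => p (k + 1)) n hgood h' heq
    change tailStart n ≤ 2 * (s : ℝ) - 1 at ih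
    rw [tailStart_succ]
    linarith

end PolylineInj

/-! ### The polygon of a cycle of `H` is a simple closed curve -/

section HexCycle

variable {f₀ g₀ : HexVertex} {δ : ℝ}

/-- The tail of the vertex list of the polygon is `[polyPt 1, …, polyPt n]`. [folklore] -/
theorem tailPts_eq_ptsList (w : hexGraph.Walk f₀ g₀) :
    tailPts δ w = ptsList (polyPt δ w) w.length := by
  apply List.ext_getElem
  · rw [length_tailPts, length_ptsList]
  · intro k h1 h2
    rw [getElem_tailPts, getElem_ptsList]

/-- The polygon of a walk of `H` is the polyline through `polyPt 0, …, polyPt n`. [folklore] -/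
theorem toCurve_eq_polylineFrom_ptsList (w : hexGraph.Walk f₀ g₀) (u : unitInterval) :
    w.toCurve (fun F ↦ (δ : ℂ) * hexCenter F) u =
      (polylineFrom (polyPt δ w 0) (ptsList (polyPt δ w) w.length)).2 u := by
  rw [toCurve_apply]
  exact congrArg (fun L => (polylineFrom (polyPt δ w 0) L).2 u) (tailPts_eq_ptsList w)

/-- In a cycle the faces `getVert 0, …, getVert n` are distinct except for
`getVert 0 = getVert n` (Mathlib's `IsCycle.getVert_injOn'`, `IsCycle.getVert_endpoint_iff`).
[folklore] -/
theorem getVert_inj_of_isCycle {w : hexGraph.Walk f₀ f₀} (hw : w.IsCycle) :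
    ∀ a b, a < b → b ≤ w.length → w.getVert a = w.getVert b → a = 0 ∧ b = w.length := by
  intro a b hab hb h
  have h3 := hw.three_le_length
  rcases Nat.lt_or_ge b w.length with hb' | hb'
  · have := hw.getVert_injOn' (by simp only [Set.mem_setOf_eq]; omega)
      (by simp only [Set.mem_setOf_eq]; omega) h
    omega
  · have hbn : b = w.length := le_antisymm hb hb'
    subst hbn
    rw [SimpleGraph.Walk.getVert_length] at h
    have := (hw.getVert_endpoint_iff (by omega)).1 h
    omega

/-- **The polygon of a cycle of the hexagonal lattice is a simple closed curve.** For a cycle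
`w` of `hexGraph` (length `n ≥ 3`) and mesh `δ ≠ 0`, if the polygon
`w.toCurve (δ · hexCenter)` takes the same value at two times `s < t`, then either `s` lies in
the final constant stretch `[1 - 2^{-n}, 1]` of the dyadic parametrisation, or `s = 0` and
`t ≥ 1 - 2^{-n}` (both at the base point). In particular the polygon is injective on
`(0, 1 - 2^{-n}]`. (Camia–Newman 2006, §4: interfaces are simple loops of the hexagonal
lattice.) [cite: CamiaNewman2006, §4] -/
theorem toCurve_eq_toCurve_of_isCycle (hδ : δ ≠ 0) {w : hexGraph.Walk f₀ f₀} (hw : w.IsCycle)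
    {s t : unitInterval} (hst : s < t)
    (heq : w.toCurve (fun F ↦ (δ : ℂ) * hexCenter F) s = w.toCurve (fun F ↦ (δ : ℂ) * hexCenter F) t) :
    tailStart w.length ≤ (s : ℝ) ∨ ((s : ℝ) = 0 ∧ tailStart w.length ≤ (t : ℝ)) := by
  have h3 := hw.three_le_length
  have hinj := getVert_inj_of_isCycle hw
  obtain ⟨n, hn⟩ : ∃ n, w.length = n + 1 := ⟨w.length - 1, by omega⟩
  rw [toCurve_eq_polylineFrom_ptsList, toCurve_eq_polylineFrom_ptsList, hn] at heq
  rw [hn]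
  refine polylineFrom_eq_of_closed (polyPt δ w) n (polyPt_ne_polyPt_succ hδ (by omega)) ?_ ?_ ?_ hst heq
  · intro m hm1 hm2 z hz hz'
    rcases polyPiece_inter_of_getVert hδ h3 hinj (show 0 < m from hm1) (by omega) hz hz' with ⟨h1, h2⟩ | ⟨-, -, h2⟩
    · exact Or.inr h2
    · exact Or.inl h2
  · refine ⟨fun k hk => polyPt_ne_polyPt_succ hδ (by omega), fun k m hkm hm z hz hz' => ?_⟩
    rcases polyPiece_inter_of_getVert hδ h3 hinj (show k + 1 < m + 1 by omega) (by omega) hz hz' with ⟨-, h2⟩ | ⟨h1, -, -⟩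
    · exact h2
    · omega
  · change (δ : ℂ) * hexCenter (w.getVert (n + 1)) = (δ : ℂ) * hexCenter (w.getVert 0)
    rw [← hn, SimpleGraph.Walk.getVert_length, SimpleGraph.Walk.getVert_zero]

/-- **Injectivity off the base point**: the polygon of a cycle of `H` is injective on the
parameter interval `(0, 1 - 2^{-n}]`. [cite: CamiaNewman2006, §4] -/
theorem toCurve_injOn_of_isCycle (hδ : δ ≠ 0) {w : hexGraph.Walk f₀ f₀} (hw : w.IsCycle) :
    Set.InjOn (w.toCurve fun F ↦ (δ : ℂ) * hexCenter F)
      {u : unitInterval | 0 < (u : ℝ) ∧ (u : ℝ) ≤ tailStart w.length} := by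
  intro s hs t ht h
  by_contra hne
  rcases lt_or_gt_of_ne hne with hlt | hlt
  · rcases toCurve_eq_toCurve_of_isCycle hδ hw hlt h with h1 | ⟨h1, -⟩
    · -- `s` in the tail and `s < t ≤ tailStart`: impossible
      have : (s : ℝ) < t := hlt
      linarith [ht.2]
    · linarith [hs.1]
  · rcases toCurve_eq_toCurve_of_isCycle hδ hw hlt h.symm with h1 | ⟨h1, -⟩
    · have : (t : ℝ) < s := hlt
      linarith [hs.2]
    · linarith [ht.1]

end HexCycle

end Literature.Probability.Percolation
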